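import Mathlib
import Summits.Ventures.PercRepro2.Defs
import Summits.Ventures.PercRepro2.Independence
import Summits.Ventures.PercRepro2.Harris
import Summits.Ventures.PercRepro2.Graph
import Summits.Ventures.PercRepro2.Exploration
import Summits.Ventures.PercRepro2.FourFunctions
import Summits.Ventures.PercRepro2.Induced
import Summits.Ventures.PercRepro2.Frontier
import Summits.Ventures.PercRepro2.ObsIndependence
import Summits.Ventures.PercRepro2.BHK

/-!
# The van den Berg–Häggström–Kahn inequality with ANTITONE cluster functionals on the meet
(blind cell PercRepro2, mine-1 g51)

`BHK.lean` (`bhk_induced`) proves, for nonnegative monotone cluster functionals `F₁, F₂` of the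
cluster `C_s` and vertex sets `X, Y` (with `R_X = {s ↮ x ∀ x ∈ X}`),

  `E[F₁(C_s) 1_{R_X}] · E[F₂(C_s) 1_{R_Y}] ≤ E[(F₁F₂)(C_s) 1_{R_{X∩Y}}] · P(R_{X∪Y})`

(van den Berg–Häggström–Kahn, RSA 29 (2006), Thm 1.1/1.3 in functional form).  This file adds
nonnegative ANTITONE cluster functionals `D₁, D₂` (decreasing in `C_s` for `⊆`), which multiply on
the MEET side:

  `E[(F₁D₁)(C_s) 1_{R_X}] · E[(F₂D₂)(C_s) 1_{R_Y}]
      ≤ E[(F₁F₂)(C_s) 1_{R_{X∩Y}}] · E[(D₁D₂)(C_s) 1_{R_{X∪Y}}]`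

(`bhk_antitone_induced`; `D₁ = D₂ = 1` is `bhk_induced`).  The proof is the same exploration
induction: when `X ∩ Y = ∅` four Harris inequalities (monotone × antitone observables are
negatively correlated, antitone × antitone positively), otherwise the edges around `Z = X ∩ Y` are
explored, the domain Markov identity of `BHK.lean` turns every term into a sum over the frontier,
and the four functions theorem on `Config E` closes the step — the antitone product lives on the
`⊔`-slot, where the avoided set is the union of the two frontiers.

Why it matters for the cell: the typical decreasing functional is `D(K) = P_{G∖K}(t ↔ z)` (the
probability, after exploring `C_s = K`, that the cluster of a second root `t` hits `z`); with it
the theorem gives two-cluster inequalities on `{s ↮ t}` such as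
`P(y ∈ C_s, z ∈ C_t) · P(z ∈ C_s, y ∈ C_t) ≤ P(y, z ∈ C_s) · P(y, z ∈ C_t)`
(paper proofs/MINE1-LSMPAIRS.md).
-/

namespace Summit.Ventures.PercRepro2

/-! ## Harris' inequality for antitone observables -/

section HarrisAntitone

variable {E : Type*} [Fintype E] [DecidableEq E] {R : Type*} [CommRing R] [LinearOrder R]
  [IsStrictOrderedRing R]

omit [LinearOrder R] [IsStrictOrderedRing R] in
/-- The expectation of `-f` is `-E f`. -/
lemma expect_neg' (p : E → R) (f : Config E → R) : expect p (-f) = -expect p f := by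
  simp [expect, Finset.sum_neg_distrib, mul_neg]

/-- **Harris, mixed form**: a monotone and an antitone observable are negatively correlated,
`E(f g) ≤ E f · E g`. -/
theorem expect_mul_le_expect_mul_expect_of_antitone {p : E → R} (hp : IsProbVec p)
    {f g : Config E → R} (hf : Monotone f) (hg : Antitone g) :
    expect p (f * g) ≤ expect p f * expect p g := by
  have hg' : Monotone (-g) := fun a b h => by
    simp only [Pi.neg_apply]
    exact neg_le_neg (hg h)
  have h := expect_mul_expect_le_expect_mul hp hf hg'
  have e : f * (-g) = -(f * g) := by ext ω; simp
  rw [e, expect_neg', expect_neg'] at h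
  linarith

/-- **Harris for antitone observables**: `E f · E g ≤ E (f g)`. -/
theorem expect_mul_expect_le_expect_mul_of_antitone {p : E → R} (hp : IsProbVec p)
    {f g : Config E → R} (hf : Antitone f) (hg : Antitone g) :
    expect p f * expect p g ≤ expect p (f * g) := by
  have hf' : Monotone (-f) := fun a b h => by
    simp only [Pi.neg_apply]
    exact neg_le_neg (hf h)
  have hg' : Monotone (-g) := fun a b h => by
    simp only [Pi.neg_apply]
    exact neg_le_neg (hg h)
  have h := expect_mul_expect_le_expect_mul hp hf' hg'
  have e : (-f) * (-g) = f * g := by ext ω; simp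
  rw [e, expect_neg', expect_neg', neg_mul_neg] at h
  exact h

omit [Fintype E] [DecidableEq E] in
/-- The product of two nonnegative antitone observables is antitone. -/
lemma antitone_mul_of_nonneg {f g : Config E → R} (hf : Antitone f) (hg : Antitone g)
    (hf0 : ∀ ω, 0 ≤ f ω) (hg0 : ∀ ω, 0 ≤ g ω) : Antitone (f * g) := by
  intro a b h
  simp only [Pi.mul_apply]
  exact mul_le_mul (hf h) (hg h) (hg0 b) (hf0 a)

omit [Fintype E] [DecidableEq E] in
/-- The indicator of a decreasing event is antitone. -/
lemma antitone_indicator_of_isLowerSet {A : Set (Config E)} (hA : IsLowerSet A) :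
    Antitone (A.indicator (1 : Config E → R)) := by
  intro a b h
  by_cases hb : b ∈ A
  · rw [Set.indicator_of_mem hb, Set.indicator_of_mem (hA h hb)]
    simp
  · rw [Set.indicator_of_notMem hb]
    exact Set.indicator_apply_nonneg fun _ => zero_le_one

end HarrisAntitone

/-! ## Antitone cluster functionals -/

section ClusterAntitone

variable {V : Type*} {E : Type*} {R : Type*} {ends : E → Sym2 V} {U : Finset V} {s : V}

/-- A functional that is antitone on the clusters of `s` (for all configurations) is an antitone
observable on every induced subgraph. -/
lemma antitone_clusterObs' [Preorder R] {D : Set V → R}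
    (hD : ∀ ω ω' : Config E, cluster ends ω s ⊆ cluster ends ω' s →
      D (cluster ends ω' s) ≤ D (cluster ends ω s)) :
    Antitone (clusterObs ends U s D) :=
  fun _ _ h => hD _ _ (clusterIn_mono h)

end ClusterAntitone

/-! ## The inequality on induced subgraphs -/

section BHKAntitoneMain

variable {V : Type*} {E : Type*} [Fintype E] [DecidableEq E] [Fintype V] [DecidableEq V]
  {R : Type*} [CommRing R] [LinearOrder R] [IsStrictOrderedRing R]

omit [Fintype V] in
/-- The case `X ∩ Y = ∅`: Harris' inequality four times. -/
lemma bhk_antitone_induced_of_inter_eq_empty (p : E → R) (hp : IsProbVec p) (ends : E → Sym2 V)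
    (s : V) (U : Finset V) {F₁ F₂ D₁ D₂ : Set V → R}
    (hF₁ : ∀ ω ω' : Config E, cluster ends ω s ⊆ cluster ends ω' s →
      F₁ (cluster ends ω s) ≤ F₁ (cluster ends ω' s))
    (hF₂ : ∀ ω ω' : Config E, cluster ends ω s ⊆ cluster ends ω' s →
      F₂ (cluster ends ω s) ≤ F₂ (cluster ends ω' s))
    (hD₁ : ∀ ω ω' : Config E, cluster ends ω s ⊆ cluster ends ω' s →
      D₁ (cluster ends ω' s) ≤ D₁ (cluster ends ω s))
    (hD₂ : ∀ ω ω' : Config E, cluster ends ω s ⊆ cluster ends ω' s →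
      D₂ (cluster ends ω' s) ≤ D₂ (cluster ends ω s))
    (hF₁0 : ∀ ω : Config E, 0 ≤ F₁ (cluster ends ω s))
    (hF₂0 : ∀ ω : Config E, 0 ≤ F₂ (cluster ends ω s))
    (hD₁0 : ∀ ω : Config E, 0 ≤ D₁ (cluster ends ω s))
    (hD₂0 : ∀ ω : Config E, 0 ≤ D₂ (cluster ends ω s)) (X Y : Finset V) (hZ : X ∩ Y = ∅) :
    expect p (clusterObs ends U s (F₁ * D₁) * (REvent ends U s X).indicator 1) *
        expect p (clusterObs ends U s (F₂ * D₂) * (REvent ends U s Y).indicator 1) ≤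
      expect p (clusterObs ends U s (F₁ * F₂) * (REvent ends U s (X ∩ Y)).indicator 1) *
        expect p (clusterObs ends U s (D₁ * D₂) * (REvent ends U s (X ∪ Y)).indicator 1) := by
  rw [hZ, REvent_empty, Set.indicator_univ, mul_one, REvent_union, clusterObs_mul, clusterObs_mul,
    clusterObs_mul, clusterObs_mul]
  have hRX := isLowerSet_REvent ends U s X
  have hRY := isLowerSet_REvent ends U s Y
  -- the observables
  set f₁ := clusterObs ends U s F₁ with hf₁
  set f₂ := clusterObs ends U s F₂ with hf₂
  set g₁ := clusterObs ends U s D₁ * (REvent ends U s X).indicator (1 : Config E → R) with hg₁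
  set g₂ := clusterObs ends U s D₂ * (REvent ends U s Y).indicator (1 : Config E → R) with hg₂
  have mf₁ : Monotone f₁ := monotone_clusterObs' (ends := ends) (U := U) (s := s) hF₁
  have mf₂ : Monotone f₂ := monotone_clusterObs' (ends := ends) (U := U) (s := s) hF₂
  have aD₁ : Antitone (clusterObs ends U s D₁) :=
    antitone_clusterObs' (ends := ends) (U := U) (s := s) hD₁
  have aD₂ : Antitone (clusterObs ends U s D₂) :=
    antitone_clusterObs' (ends := ends) (U := U) (s := s) hD₂
  have nD₁ : ∀ ω, 0 ≤ clusterObs ends U s D₁ ω := fun ω => hD₁0 _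
  have nD₂ : ∀ ω, 0 ≤ clusterObs ends U s D₂ ω := fun ω => hD₂0 _
  have nI : ∀ (A : Set (Config E)) ω, 0 ≤ A.indicator (1 : Config E → R) ω :=
    fun A ω => Set.indicator_apply_nonneg fun _ => zero_le_one
  have ag₁ : Antitone g₁ :=
    antitone_mul_of_nonneg aD₁ (antitone_indicator_of_isLowerSet hRX) nD₁ (nI _)
  have ag₂ : Antitone g₂ :=
    antitone_mul_of_nonneg aD₂ (antitone_indicator_of_isLowerSet hRY) nD₂ (nI _)
  have ng₁ : ∀ ω, 0 ≤ g₁ ω := fun ω => mul_nonneg (nD₁ ω) (nI _ ω)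
  have ng₂ : ∀ ω, 0 ≤ g₂ ω := fun ω => mul_nonneg (nD₂ ω) (nI _ ω)
  -- the four Harris inequalities
  have h1 : expect p (f₁ * g₁) ≤ expect p f₁ * expect p g₁ :=
    expect_mul_le_expect_mul_expect_of_antitone hp mf₁ ag₁
  have h2 : expect p (f₂ * g₂) ≤ expect p f₂ * expect p g₂ :=
    expect_mul_le_expect_mul_expect_of_antitone hp mf₂ ag₂
  have h3 : expect p f₁ * expect p f₂ ≤ expect p (f₁ * f₂) :=
    expect_mul_expect_le_expect_mul hp mf₁ mf₂
  have h4 : expect p g₁ * expect p g₂ ≤ expect p (g₁ * g₂) :=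
    expect_mul_expect_le_expect_mul_of_antitone hp ag₁ ag₂
  -- the left side is `E(f₁ g₁) E(f₂ g₂)`, the right side `E(f₁ f₂) E(g₁ g₂)`
  have eL₁ : clusterObs ends U s F₁ * clusterObs ends U s D₁ *
      (REvent ends U s X).indicator (1 : Config E → R) = f₁ * g₁ := by
    rw [hf₁, hg₁]; ring
  have eL₂ : clusterObs ends U s F₂ * clusterObs ends U s D₂ *
      (REvent ends U s Y).indicator (1 : Config E → R) = f₂ * g₂ := by
    rw [hf₂, hg₂]; ring
  have eR : clusterObs ends U s D₁ * clusterObs ends U s D₂ *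
      (REvent ends U s X ∩ REvent ends U s Y).indicator (1 : Config E → R) = g₁ * g₂ := by
    rw [hg₁, hg₂]
    ext ω
    simp only [Pi.mul_apply]
    rw [indicator_inter_one]
    ring
  rw [eL₁, eL₂, eR]
  have n1 : 0 ≤ expect p (f₂ * g₂) := expect_nonneg hp fun ω => mul_nonneg (hF₂0 _) (ng₂ ω)
  have n2 : 0 ≤ expect p f₁ := expect_nonneg hp fun ω => hF₁0 _
  have n3 : 0 ≤ expect p (f₁ * f₂) := expect_nonneg hp fun ω => mul_nonneg (hF₁0 _) (hF₂0 _)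
  have n4 : 0 ≤ expect p g₁ := expect_nonneg hp ng₁
  have n5 : 0 ≤ expect p g₂ := expect_nonneg hp ng₂
  calc expect p (f₁ * g₁) * expect p (f₂ * g₂)
      ≤ (expect p f₁ * expect p g₁) * (expect p f₂ * expect p g₂) :=
        mul_le_mul h1 h2 n1 (mul_nonneg n2 n4)
    _ = (expect p f₁ * expect p f₂) * (expect p g₁ * expect p g₂) := by ring
    _ ≤ expect p (f₁ * f₂) * expect p (g₁ * g₂) :=
        mul_le_mul h3 h4 (mul_nonneg n4 n5) n3

/-- **van den Berg–Häggström–Kahn with antitone functionals on induced subgraphs** (minimal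
hypotheses): for cluster functionals `F₁, F₂` nonnegative and monotone on the clusters of `s`,
`D₁, D₂` nonnegative and antitone on them, every vertex set `U` and `X, Y ⊆ U`,
`E((F₁D₁)(C^U_s) 1_{R^U_X}) · E((F₂D₂)(C^U_s) 1_{R^U_Y})
  ≤ E((F₁F₂)(C^U_s) 1_{R^U_{X∩Y}}) · E((D₁D₂)(C^U_s) 1_{R^U_{X∪Y}})`. -/
theorem bhk_antitone_induced' (p : E → R) (hp : IsProbVec p) (ends : E → Sym2 V) (s : V)
    {F₁ F₂ D₁ D₂ : Set V → R}
    (hF₁ : ∀ ω ω' : Config E, cluster ends ω s ⊆ cluster ends ω' s →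
      F₁ (cluster ends ω s) ≤ F₁ (cluster ends ω' s))
    (hF₂ : ∀ ω ω' : Config E, cluster ends ω s ⊆ cluster ends ω' s →
      F₂ (cluster ends ω s) ≤ F₂ (cluster ends ω' s))
    (hD₁ : ∀ ω ω' : Config E, cluster ends ω s ⊆ cluster ends ω' s →
      D₁ (cluster ends ω' s) ≤ D₁ (cluster ends ω s))
    (hD₂ : ∀ ω ω' : Config E, cluster ends ω s ⊆ cluster ends ω' s →
      D₂ (cluster ends ω' s) ≤ D₂ (cluster ends ω s))
    (hF₁0 : ∀ ω : Config E, 0 ≤ F₁ (cluster ends ω s))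
    (hF₂0 : ∀ ω : Config E, 0 ≤ F₂ (cluster ends ω s))
    (hD₁0 : ∀ ω : Config E, 0 ≤ D₁ (cluster ends ω s))
    (hD₂0 : ∀ ω : Config E, 0 ≤ D₂ (cluster ends ω s)) (U : Finset V) :
    ∀ X Y : Finset V, X ⊆ U → Y ⊆ U →
      expect p (clusterObs ends U s (F₁ * D₁) * (REvent ends U s X).indicator 1) *
          expect p (clusterObs ends U s (F₂ * D₂) * (REvent ends U s Y).indicator 1) ≤
        expect p (clusterObs ends U s (F₁ * F₂) * (REvent ends U s (X ∩ Y)).indicator 1) *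
          expect p (clusterObs ends U s (D₁ * D₂) * (REvent ends U s (X ∪ Y)).indicator 1) := by
  have hFD₁0 : ∀ ω : Config E, 0 ≤ (F₁ * D₁) (cluster ends ω s) :=
    fun ω => mul_nonneg (hF₁0 ω) (hD₁0 ω)
  have hFD₂0 : ∀ ω : Config E, 0 ≤ (F₂ * D₂) (cluster ends ω s) :=
    fun ω => mul_nonneg (hF₂0 ω) (hD₂0 ω)
  have hFF0 : ∀ ω : Config E, 0 ≤ (F₁ * F₂) (cluster ends ω s) :=
    fun ω => mul_nonneg (hF₁0 ω) (hF₂0 ω)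
  have hDD0 : ∀ ω : Config E, 0 ≤ (D₁ * D₂) (cluster ends ω s) :=
    fun ω => mul_nonneg (hD₁0 ω) (hD₂0 ω)
  induction U using Finset.strongInduction with
  | H U ih =>
  intro X Y hX hY
  by_cases hZ : X ∩ Y = ∅
  · exact bhk_antitone_induced_of_inter_eq_empty p hp ends s U hF₁ hF₂ hD₁ hD₂ hF₁0 hF₂0 hD₁0
      hD₂0 X Y hZ
  -- the exploration step: `Z = X ∩ Y ≠ ∅`
  set Z := X ∩ Y with hZdef
  have hZX : Z ⊆ X := Finset.inter_subset_left
  have hZY : Z ⊆ Y := Finset.inter_subset_right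
  have hZU : Z ⊆ U := hZX.trans hX
  by_cases hsZ : s ∈ Z
  · -- `s ∈ X`: the left side vanishes
    have h0 : expect p (clusterObs ends U s (F₁ * D₁) * (REvent ends U s X).indicator 1) = 0 := by
      rw [REvent_eq_empty_of_mem ends U (hZX hsZ)]
      simp [expect]
    rw [h0, zero_mul]
    exact mul_nonneg (expect_nonneg hp (clusterObs_mul_indicator_nonneg ends U s hFF0 _))
      (expect_nonneg hp (clusterObs_mul_indicator_nonneg ends U s hDD0 _))
  have hU' : U \ Z ⊂ U := Finset.sdiff_ssubset hZU (Finset.nonempty_iff_ne_empty.2 hZ)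
  -- the four terms as sums over configurations (domain Markov identity)
  have e1 : expect p (clusterObs ends U s (F₁ * D₁) * (REvent ends U s X).indicator 1) =
      ∑ ω, weight p ω * expect p (clusterObs ends (U \ Z) s (F₁ * D₁) *
        (REvent ends (U \ Z) s ((X \ Z) ∪ frontier ends U Z ω)).indicator 1) := by
    rw [← expect_clusterObs_mul_indicator_eq_sum p ends hZU hsZ (F₁ * D₁) (X \ Z),
      Finset.sdiff_union_of_subset hZX]
  have e2 : expect p (clusterObs ends U s (F₂ * D₂) * (REvent ends U s Y).indicator 1) =
      ∑ ω, weight p ω * expect p (clusterObs ends (U \ Z) s (F₂ * D₂) *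
        (REvent ends (U \ Z) s ((Y \ Z) ∪ frontier ends U Z ω)).indicator 1) := by
    rw [← expect_clusterObs_mul_indicator_eq_sum p ends hZU hsZ (F₂ * D₂) (Y \ Z),
      Finset.sdiff_union_of_subset hZY]
  have e3 : expect p (clusterObs ends U s (F₁ * F₂) * (REvent ends U s Z).indicator 1) =
      ∑ ω, weight p ω * expect p (clusterObs ends (U \ Z) s (F₁ * F₂) *
        (REvent ends (U \ Z) s (∅ ∪ frontier ends U Z ω)).indicator 1) := by
    rw [← expect_clusterObs_mul_indicator_eq_sum p ends hZU hsZ (F₁ * F₂) ∅, Finset.empty_union]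
  have e4 : expect p (clusterObs ends U s (D₁ * D₂) * (REvent ends U s (X ∪ Y)).indicator 1) =
      ∑ ω, weight p ω * expect p (clusterObs ends (U \ Z) s (D₁ * D₂) *
        (REvent ends (U \ Z) s (((X \ Z) ∪ (Y \ Z)) ∪ frontier ends U Z ω)).indicator 1) := by
    rw [← expect_clusterObs_mul_indicator_eq_sum p ends hZU hsZ (D₁ * D₂) ((X \ Z) ∪ (Y \ Z)),
      ← Finset.union_sdiff_distrib,
      Finset.sdiff_union_of_subset (hZX.trans Finset.subset_union_left)]
  rw [e1, e2, e3, e4]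
  -- the four functions theorem on the lattice `Config E`
  refine four_functions_theorem_univ
    (fun ω => weight p ω * expect p (clusterObs ends (U \ Z) s (F₁ * D₁) *
      (REvent ends (U \ Z) s ((X \ Z) ∪ frontier ends U Z ω)).indicator 1))
    (fun ω => weight p ω * expect p (clusterObs ends (U \ Z) s (F₂ * D₂) *
      (REvent ends (U \ Z) s ((Y \ Z) ∪ frontier ends U Z ω)).indicator 1))
    (fun ω => weight p ω * expect p (clusterObs ends (U \ Z) s (F₁ * F₂) *
      (REvent ends (U \ Z) s (∅ ∪ frontier ends U Z ω)).indicator 1))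
    (fun ω => weight p ω * expect p (clusterObs ends (U \ Z) s (D₁ * D₂) *
      (REvent ends (U \ Z) s (((X \ Z) ∪ (Y \ Z)) ∪ frontier ends U Z ω)).indicator 1))
    (fun ω => mul_nonneg (weight_nonneg hp ω)
      (expect_nonneg hp (clusterObs_mul_indicator_nonneg ends _ s hFD₁0 _)))
    (fun ω => mul_nonneg (weight_nonneg hp ω)
      (expect_nonneg hp (clusterObs_mul_indicator_nonneg ends _ s hFD₂0 _)))
    (fun ω => mul_nonneg (weight_nonneg hp ω)
      (expect_nonneg hp (clusterObs_mul_indicator_nonneg ends _ s hFF0 _)))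
    (fun ω => mul_nonneg (weight_nonneg hp ω)
      (expect_nonneg hp (clusterObs_mul_indicator_nonneg ends _ s hDD0 _))) ?_
  intro ω ω'
  -- induction hypothesis on `U ∖ Z` with the frontiers added to the avoided sets
  have hX'' : (X \ Z) ∪ frontier ends U Z ω ⊆ U \ Z :=
    Finset.union_subset (Finset.sdiff_subset_sdiff hX (le_refl Z)) (frontier_subset ω)
  have hY'' : (Y \ Z) ∪ frontier ends U Z ω' ⊆ U \ Z :=
    Finset.union_subset (Finset.sdiff_subset_sdiff hY (le_refl Z)) (frontier_subset ω')
  have hIH := ih (U \ Z) hU' ((X \ Z) ∪ frontier ends U Z ω) ((Y \ Z) ∪ frontier ends U Z ω')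
    hX'' hY''
  -- `S(ω ⊓ ω') ⊆ S(ω) ∩ S(ω') ⊆ X'' ∩ Y''`
  have h3 : expect p (clusterObs ends (U \ Z) s (F₁ * F₂) * (REvent ends (U \ Z) s
      (((X \ Z) ∪ frontier ends U Z ω) ∩ ((Y \ Z) ∪ frontier ends U Z ω'))).indicator 1) ≤
      expect p (clusterObs ends (U \ Z) s (F₁ * F₂) *
        (REvent ends (U \ Z) s (∅ ∪ frontier ends U Z (ω ⊓ ω'))).indicator 1) := by
    refine expect_clusterObs_mul_indicator_mono hp ends _ s hFF0 (REvent_anti _ _ _ ?_)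
    rw [Finset.empty_union]
    exact (frontier_inf_subset ω ω').trans
      (Finset.inter_subset_inter Finset.subset_union_right Finset.subset_union_right)
  -- `X'' ∪ Y'' = (X' ∪ Y') ∪ S(ω ⊔ ω')`
  have h4 : expect p (clusterObs ends (U \ Z) s (D₁ * D₂) * (REvent ends (U \ Z) s
      (((X \ Z) ∪ frontier ends U Z ω) ∪ ((Y \ Z) ∪ frontier ends U Z ω'))).indicator 1) =
      expect p (clusterObs ends (U \ Z) s (D₁ * D₂) *
        (REvent ends (U \ Z) s (((X \ Z) ∪ (Y \ Z)) ∪ frontier ends U Z (ω ⊔ ω'))).indicator 1) := by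
    have hset : ((X \ Z) ∪ frontier ends U Z ω) ∪ ((Y \ Z) ∪ frontier ends U Z ω') =
        ((X \ Z) ∪ (Y \ Z)) ∪ frontier ends U Z (ω ⊔ ω') := by
      rw [frontier_sup]
      ext x
      simp only [Finset.mem_union]
      tauto
    rw [hset]
  have n3 : 0 ≤ expect p (clusterObs ends (U \ Z) s (F₁ * F₂) *
      (REvent ends (U \ Z) s (∅ ∪ frontier ends U Z (ω ⊓ ω'))).indicator 1) :=
    expect_nonneg hp (clusterObs_mul_indicator_nonneg ends _ s hFF0 _)
  have n4 : 0 ≤ expect p (clusterObs ends (U \ Z) s (D₁ * D₂) * (REvent ends (U \ Z) s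
      (((X \ Z) ∪ frontier ends U Z ω) ∪ ((Y \ Z) ∪ frontier ends U Z ω'))).indicator 1) :=
    expect_nonneg hp (clusterObs_mul_indicator_nonneg ends _ s hDD0 _)
  calc weight p ω * expect p (clusterObs ends (U \ Z) s (F₁ * D₁) *
          (REvent ends (U \ Z) s ((X \ Z) ∪ frontier ends U Z ω)).indicator 1) *
        (weight p ω' * expect p (clusterObs ends (U \ Z) s (F₂ * D₂) *
          (REvent ends (U \ Z) s ((Y \ Z) ∪ frontier ends U Z ω')).indicator 1))
      = (weight p ω * weight p ω') *
          (expect p (clusterObs ends (U \ Z) s (F₁ * D₁) *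
            (REvent ends (U \ Z) s ((X \ Z) ∪ frontier ends U Z ω)).indicator 1) *
          expect p (clusterObs ends (U \ Z) s (F₂ * D₂) *
            (REvent ends (U \ Z) s ((Y \ Z) ∪ frontier ends U Z ω')).indicator 1)) := by ring
    _ ≤ (weight p ω * weight p ω') *
          (expect p (clusterObs ends (U \ Z) s (F₁ * F₂) *
            (REvent ends (U \ Z) s (∅ ∪ frontier ends U Z (ω ⊓ ω'))).indicator 1) *
          expect p (clusterObs ends (U \ Z) s (D₁ * D₂) *
            (REvent ends (U \ Z) s (((X \ Z) ∪ (Y \ Z)) ∪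
              frontier ends U Z (ω ⊔ ω'))).indicator 1)) :=
        mul_le_mul_of_nonneg_left (hIH.trans (mul_le_mul h3 (le_of_eq h4) n4 n3))
          (mul_nonneg (weight_nonneg hp ω) (weight_nonneg hp ω'))
    _ = weight p (ω ⊓ ω') * expect p (clusterObs ends (U \ Z) s (F₁ * F₂) *
          (REvent ends (U \ Z) s (∅ ∪ frontier ends U Z (ω ⊓ ω'))).indicator 1) *
        (weight p (ω ⊔ ω') * expect p (clusterObs ends (U \ Z) s (D₁ * D₂) *
          (REvent ends (U \ Z) s (((X \ Z) ∪ (Y \ Z)) ∪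
            frontier ends U Z (ω ⊔ ω'))).indicator 1)) := by
        rw [← weight_inf_mul_weight_sup p ω ω']
        ring

/-- **van den Berg–Häggström–Kahn with antitone functionals on induced subgraphs**: for nonnegative
monotone cluster functionals `F₁, F₂` and nonnegative antitone cluster functionals `D₁, D₂`,
every vertex set `U` and `X, Y ⊆ U`,
`E((F₁D₁)(C^U_s) 1_{R^U_X}) · E((F₂D₂)(C^U_s) 1_{R^U_Y})
  ≤ E((F₁F₂)(C^U_s) 1_{R^U_{X∩Y}}) · E((D₁D₂)(C^U_s) 1_{R^U_{X∪Y}})`. -/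
theorem bhk_antitone_induced (p : E → R) (hp : IsProbVec p) (ends : E → Sym2 V) (s : V)
    {F₁ F₂ D₁ D₂ : Set V → R} (hF₁ : Monotone F₁) (hF₂ : Monotone F₂) (hD₁ : Antitone D₁)
    (hD₂ : Antitone D₂) (hF₁0 : ∀ S, 0 ≤ F₁ S) (hF₂0 : ∀ S, 0 ≤ F₂ S) (hD₁0 : ∀ S, 0 ≤ D₁ S)
    (hD₂0 : ∀ S, 0 ≤ D₂ S) (U : Finset V) :
    ∀ X Y : Finset V, X ⊆ U → Y ⊆ U →
      expect p (clusterObs ends U s (F₁ * D₁) * (REvent ends U s X).indicator 1) *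
          expect p (clusterObs ends U s (F₂ * D₂) * (REvent ends U s Y).indicator 1) ≤
        expect p (clusterObs ends U s (F₁ * F₂) * (REvent ends U s (X ∩ Y)).indicator 1) *
          expect p (clusterObs ends U s (D₁ * D₂) * (REvent ends U s (X ∪ Y)).indicator 1) :=
  bhk_antitone_induced' p hp ends s (fun _ _ h => hF₁ h) (fun _ _ h => hF₂ h)
    (fun _ _ h => hD₁ h) (fun _ _ h => hD₂ h) (fun _ => hF₁0 _) (fun _ => hF₂0 _)
    (fun _ => hD₁0 _) (fun _ => hD₂0 _) U

end BHKAntitoneMain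

end Summit.Ventures.PercRepro2
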